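import Literature.Topology.FourManifolds.Trisections
import Literature.Topology.FourManifolds.ImmersionOrientation
import Literature.Topology.FourManifolds.InteriorOrientationExtension
import Literature.Topology.FourManifolds.BallGluingCharts
import HarnessLib

/-!
# The sector piece `W` of a Gay–Kirby trisection of an orientable `4`-manifold is orientable

Helper file (`--supports stmt-SmoothPoincare4-18000`, registered helper
`helper_isOrientable_sector_of_clause_ii` of the skeleton
`Cruxes/DependentTripleGenusThreeStandard/Lines/Sketch.lean`, setting of stub 3b: Aranda–Zupan's
Lemma 3.8 needs the sector boundary `∂X_i` of a `(3;1,1,1)`-trisection as a closed orientable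
`3`-manifold).

Clause (ii) of the tree's predicate `IsGKTrisection M g k T` (`Trisections.lean`) presents the
sector `T i` as the image of a topological embedding `e : W → M` of a compact connected smooth
`4`-manifold with boundary `W` which is a `C^∞` immersion at every point not mapped to the
central surface `F = ⋂ l, T l` and has a corner chart (`IsCornerAt`) at every point mapped to `F`.
We prove:

* `not_isInteriorPoint_of_isCornerAt` — **corner points are boundary points**: a corner chart
  `φ` of the maximal atlas has `(φ w).val = 0`, whose first coordinate is not `> 0`
  (boundary invariance for the maximal atlas, `isInteriorPoint_iff_of_mem_maximalAtlas`);
* `isOrientable_interiorManifold_sector` — hence the boundaryless interior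
  `InteriorManifold (𝓡∂ 4) W` is mapped by `e ∘ val` through `C^∞` immersions only, a
  codimension-`0` immersion into `M`, and inherits an orientation from `M`
  (`SmoothOrientation.comapOfDetNeZero`; Hirsch, *Differential Topology* (1976), §4.4, p. 101);
* `helper_isOrientable_sector_of_clause_ii` (REGISTERED helper) — **`W` is orientable**: an
  orientation of the interior of a manifold with boundary extends
  (`IsOrientable.of_interiorManifold_euclideanHalfSpace`, `InteriorOrientationExtension.lean`).

This is the clause-(ii) analogue of the tree's clause-(iii) theorems
`IsGKTrisection.isOrientable_interiorManifold_of_clause_iii` /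
`IsGKTrisection.isOrientable_of_clause_iii`.  Everything is proved; no definitions, no named
facts.

References: D. Gay, R. Kirby, *Trisecting 4-manifolds*, Geom. Topol. 20 (2016), Def. 1;
M. W. Hirsch, *Differential Topology* (1976), §4.4 pp. 101–104; J. M. Lee, *Introduction to
Smooth Manifolds* (2013), Thm. 1.46, Prop. 15.5 ff.
-/

-- the registered namespace `Summit.SmoothPoincare4.SmoothPoincare4.Theorems…` repeats a component
set_option linter.dupNamespace false

noncomputable section

open scoped Manifold ContDiff Topology
open Set Function
open Literature.Topology.FourManifolds

namespace Summit.SmoothPoincare4.SmoothPoincare4.Theorems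

variable {M : Type} [TopologicalSpace M] [ChartedSpace (EuclideanSpace ℝ (Fin 4)) M]
  {W : Type} [TopologicalSpace W] [ChartedSpace (EuclideanHalfSpace 4) W]

/-- **Corner points are boundary points**: if `e : W → M` has a corner chart at `w`
(`IsCornerAt e w`: a chart `φ` of the maximal `C^∞` atlas of `W` at `w` with `(φ w).val = 0`),
then `w` is not an interior point of `W` (smooth invariance of the boundary for the maximal
atlas). [cite: LeeSmoothManifolds2013, Thm. 1.46] -/
theorem not_isInteriorPoint_of_isCornerAt [IsManifold (𝓡∂ 4) ∞ W] {e : W → M} {w : W}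
    (h : IsCornerAt e w) : ¬ (𝓡∂ 4).IsInteriorPoint w := by
  obtain ⟨φ, ψ, A, hφ, -, hw, -, hw0, -⟩ := h
  rw [isInteriorPoint_iff_of_mem_maximalAtlas (I := 𝓡∂ 4) (m := ∞) (by simp) hφ hw,
    interior_range_modelWithCornersEuclideanHalfSpace]
  have hext : φ.extend (𝓡∂ 4) w = (φ w).val := rfl
  rw [hext, hw0]
  simp

variable [IsManifold (𝓡 4) ∞ M] [IsManifold (𝓡∂ 4) ∞ W]

/-- **The interior of the sector piece `W` is orientable**: at an interior point `w` of `W`,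
`e w ∉ F` (points over `F` are corner points, hence boundary points), so `e` is a `C^∞` immersion
there; thus `e ∘ val : InteriorManifold (𝓡∂ 4) W → M` is a `C^∞` codimension-`0` immersion and an
orientation of `M` pulls back (`SmoothOrientation.comapOfDetNeZero`).
[cite: HirschDT1976, §4.4 p. 101] -/
theorem isOrientable_interiorManifold_sector (hM : IsOrientable (𝓡 4) M) {F : Set M} (e : W → M)
    (himm : ∀ w, e w ∉ F → Manifold.IsImmersionAt (𝓡∂ 4) (𝓡 4) ∞ e w)
    (hcorner : ∀ w, e w ∈ F → IsCornerAt e w) :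
    IsOrientable 𝓘(ℝ, EuclideanSpace ℝ (Fin 4)) (InteriorManifold (𝓡∂ 4) W) := by
  -- interior points are not mapped into `F`
  have key : ∀ x : InteriorManifold (𝓡∂ 4) W, e x.val ∉ F := fun x hx =>
    not_isInteriorPoint_of_isCornerAt (hcorner x.val hx) x.isInteriorPoint
  have himm' : ∀ x : InteriorManifold (𝓡∂ 4) W,
      Manifold.IsImmersionAt (𝓡∂ 4) (𝓡 4) ∞ e x.val := fun x => himm x.val (key x)
  -- `e ∘ val` is `C^∞`
  have hsmooth : ContMDiff 𝓘(ℝ, EuclideanSpace ℝ (Fin 4)) (𝓡 4) ∞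
      (e ∘ (InteriorManifold.val : InteriorManifold (𝓡∂ 4) W → W)) := fun x =>
    (himm' x).contMDiffAt.comp x (InteriorManifold.contMDiffAt_val x)
  -- its differential is injective, hence has nonzero determinant
  have hdet : ∀ x : InteriorManifold (𝓡∂ 4) W,
      LinearMap.det (M := EuclideanSpace ℝ (Fin 4))
        (mfderiv 𝓘(ℝ, EuclideanSpace ℝ (Fin 4)) (𝓡 4)
          (e ∘ (InteriorManifold.val : InteriorManifold (𝓡∂ 4) W → W)) x).toLinearMap ≠ 0 := by
    intro x
    have hd1 : MDifferentiableAt (𝓡∂ 4) (𝓡 4) e x.val :=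
      (himm' x).contMDiffAt.mdifferentiableAt (by simp)
    have hd2 : MDifferentiableAt 𝓘(ℝ, EuclideanSpace ℝ (Fin 4)) (𝓡∂ 4)
        (InteriorManifold.val : InteriorManifold (𝓡∂ 4) W → W) x :=
      (InteriorManifold.contMDiffAt_val x).mdifferentiableAt (by simp)
    have hval : mfderiv 𝓘(ℝ, EuclideanSpace ℝ (Fin 4)) (𝓡∂ 4)
        (InteriorManifold.val : InteriorManifold (𝓡∂ 4) W → W) x =
          ContinuousLinearMap.id ℝ (EuclideanSpace ℝ (Fin 4)) := by
      have h := InteriorManifold.mfderiv_eq_mfderiv_comp_val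
        (J := 𝓘(ℝ, EuclideanSpace ℝ (Fin 4)))
        (id : InteriorManifold (𝓡∂ 4) W → InteriorManifold (𝓡∂ 4) W) x
      rw [mfderiv_id] at h
      exact h.symm
    have hinj : Injective (mfderiv 𝓘(ℝ, EuclideanSpace ℝ (Fin 4)) (𝓡 4)
        (e ∘ (InteriorManifold.val : InteriorManifold (𝓡∂ 4) W → W)) x) := by
      rw [mfderiv_comp x hd1 hd2, hval]
      intro v₁ v₂ hv
      exact injective_mfderiv_of_isImmersionAt' (himm' x) hv
    set A : EuclideanSpace ℝ (Fin 4) →ₗ[ℝ] EuclideanSpace ℝ (Fin 4) :=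
      (mfderiv 𝓘(ℝ, EuclideanSpace ℝ (Fin 4)) (𝓡 4)
        (e ∘ (InteriorManifold.val : InteriorManifold (𝓡∂ 4) W → W)) x).toLinearMap with hA
    have hinjA : Injective A := hinj
    have hunit : IsUnit A :=
      (LinearMap.isUnit_iff_ker_eq_bot A).2 (LinearMap.ker_eq_bot.2 hinjA)
    exact ((LinearMap.isUnit_iff_isUnit_det A).1 hunit).ne_zero
  obtain ⟨o⟩ := hM
  exact ⟨o.comapOfDetNeZero _ hsmooth (by simp) hdet⟩

/-- **The sector piece `W` of clause (ii) of a Gay–Kirby trisection of an orientable `4`-manifold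
is orientable.**  The hypotheses after `IsGKTrisection M g k T → ∀ i` are verbatim the components
of clause (ii) for the sector `T i` (`obtain ⟨W, _, _, e, hM, hW, hc, hh, he, hrange, himm,
hcorner, -⟩ := hT.2.1 i`); only the immersion and corner clauses are used: the interior of `W`
immerses into `M` (`isOrientable_interiorManifold_sector`) and orientability of a manifold with
boundary is decided on its interior (`IsOrientable.of_interiorManifold_euclideanHalfSpace`).
Gay–Kirby, Def. 1: `X_i ≅ ♮^{k_i}(S¹ × B³)` is in particular orientable; this is the part of
that assertion which the tree's predicate leaves to be derived from the orientation of `M`.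
[cite: GayKirby2016, Def. 1] [cite: HirschDT1976, §4.4 pp. 101–104] -/
theorem helper_isOrientable_sector_of_clause_ii :
    ∀ (M : Type) [TopologicalSpace M] [T2Space M] [SecondCountableTopology M]
      [ChartedSpace (EuclideanSpace ℝ (Fin 4)) M] [IsManifold (𝓡 4) ∞ M],
      IsOrientable (𝓡 4) M →
      ∀ (g : ℕ) (k : Fin 3 → ℕ) (T : Fin 3 → Set M), IsGKTrisection M g k T → ∀ (i : Fin 3)
      (W : Type) [TopologicalSpace W] [ChartedSpace (EuclideanHalfSpace 4) W] [IsManifold (𝓡∂ 4) ∞ W]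
      (e : W → M), CompactSpace W → ConnectedSpace W →
      HasHandleDecomposition 3 W (handleCount 1 (k i)) →
      Topology.IsEmbedding e → range e = T i →
      (∀ w, e w ∉ (⋂ l, T l) → Manifold.IsImmersionAt (𝓡∂ 4) (𝓡 4) ∞ e w) →
      (∀ w, e w ∈ (⋂ l, T l) → IsCornerAt e w) →
      IsOrientable (𝓡∂ 4) W := by
  intro M _ _ _ _ _ hM g k T _ i W _ _ _ e _ _ _ _ _ himm hcorner
  exact IsOrientable.of_interiorManifold_euclideanHalfSpace
    (isOrientable_interiorManifold_sector hM e himm hcorner)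

end Summit.SmoothPoincare4.SmoothPoincare4.Theorems
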